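import Literature.MathematicalPhysics.QuantumFieldTheory.Balaban1983to89.B9Eq319CentreLiftL2
import Literature.MathematicalPhysics.QuantumFieldTheory.Balaban1983to89.B9Eq319QprimeLipschitzTwoBackgrounds

/-!
# `Balaban1983to89.B9Eq319CentreLiftL2TwoBackgrounds` — T. Bałaban, *Propagators for lattice gauge theories in a background field*, Commun. Math.
# Phys. **99** (1985) 389–434 [Balaban1985BackgroundPropagators] (3.19) p. 393 with (3.11) p. 392 and (3.65)∕(3.68) p. 403, (3.76) p. 405: THE
# TWO-BACKGROUND `Q′`-REMAINDER THROUGH THE CENTRE LIFT, VOLUME-FREE — `‖S₀(Q′(U)λ − Q′(U′)λ)‖ ≤ √(L^d)·d(L−1)·δ·(1+ε)^{d(L−1)}·‖λ‖` —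
# the two-background twin of ne9-leaf-03's `B9Eq319CentreLiftL2` §2 (flat: `‖S₀(Q′(U)λ − Q′(1)λ)‖ ≤ √(L^d)·ρ′·‖λ‖`)

statement-level skeleton of published theorems with citation tags; proofs where landed; nothing here is a claim
about the Yang–Mills mass gap

CITATION HEADER (lean-in-tree rule 2026-08-18).  Audit cell `pub-balaban`, sub-cell `t4`, NE9 crux team (2): LEAF PROVER 06
(`b2b-balaban-t4-ne9-formalise-leaf-06` gen 62), INTENT I-ne9leaf06-g62-2 (journal `CLAIMS.log`; first refusal ne9-leaf-03 — author of
`B9Eq319CentreLiftL2` (gen 58), whose §1 `norm_sq_centreLift_eq` ∕ `norm_centreLift_le_of_sum_sq_le` is REUSED BY NAME; second ne9-leaf-04 — author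
of (ρ′)₂ `B9Eq319QprimeLipschitzTwoBackgrounds` (its Hilbert-currency letter `sum_norm_sq_QprimeW_sub_QprimeW_le` is the other input) and of the
consumer (Q3a)₂ `B9Eq368RLipschitzTwoBackgrounds`).  Sources: [B9] = [Balaban1985BackgroundPropagators] (journal page = PDF page + 388): (3.19) p. 393,
(3.11) p. 392, (3.65)∕(3.68) p. 403, (3.76) p. 405 — TYPES and loci only; nothing printed is asserted.

WHY THIS FILE (cell context).  The abstract projection-remainder lemmas `B9Eq368ProjectionRemainder.modulus_perturbed` ∕ `norm_projR_sub_projR_le` see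
the right inverse `S₀` of `Q′` ONLY through the composite letters `‖S₀(Q′₁l − Q′₂l)‖ ≤ ρ‖l‖`.  (Q3a)₂ `B9Eq368RLipschitzTwoBackgrounds` (today) fills
them as `‖S₀‖_{∞→L²}·‖Q′₁ − Q′₂‖_{L²→∞}` with `‖S₀‖_{∞→L²} ≤ C_S = L^d√(c₀·|T|)` — the one factor through which its `C_R`, `ε_R` depend on the
VOLUME (its header: «NOT uniformity in the volume (the centre lift's C_S ∼ √|T|)»).  ne9-leaf-03's `B9Eq319CentreLiftL2` removed that factor for the
FLAT composite (`Q′(U)` against `Q′(1)`) by the exact Hilbert norm of the centre lift + (ρ′)'s Hilbert currency; this file does the same for the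
TWO-BACKGROUND composite (`Q′(U)` against `Q′(U′)`) with (ρ′)₂'s Hilbert currency — the `hρ₂`-slots of (Q3a)₂.  With both files a re-instantiation of
(Q3a)∕(Q3a)₂ (the authors') has volume-free `ρ`-letters.

WHAT IS PROVED (sorry-free; no `Prop` placeholder; no definition).
* **`norm_centreLift_QprimeW_sub_QprimeW_le`** — under (ρ′)₂'s fibre letters (`‖R(U(b))w − w‖, ‖R(U′(b))w − w‖ ≤ ε‖w‖`, `‖R(U(b))w − R(U′(b))w‖ ≤ δ‖w‖`):
  `‖S₀(Q′(U)λ − Q′(U′)λ)‖ ≤ √(L^d)·(d(L−1)·δ·(1+ε)^{d(L−1)})·‖λ‖` for every `λ` of `SiteL2K ℂ d (L·m) c₀ W`;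
* **`norm_centreLift_QprimeW_sub_QprimeW_le_linear`** — for `ε ≤ 1`: `≤ √(L^d)·(d(L−1)·2^{d(L−1)})·δ·‖λ‖` (the shape of (Q3a)₂'s `C_ρ`-letters, `c₀`-free).
MODEL / DECLARED READINGS.  (M1)–(M2) as `B9Eq319CentreLiftL2`: one averaging step on `TSite d (L·m)`, blocks of side `L`, weighted `L²` carrier with
constant weight `c₀ > 0`, `W`-valued parameters; transporters enter only through the displayed `ε`, `δ`.  (M3) constants per `(d, L)`; INDEPENDENT of the
volume `m` and of `c₀`; NOT print's (3.81)∕(3.83) multi-level statements; no uniformity of [B9] Thm 3.11 claimed.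
HONEST SCOPE.  [folklore] one landed identity + one landed inequality composed BY NAME; one displayed slot of the `R(U)` letters made volume-free for
two backgrounds; NOT those letters (their re-run is the authors'), NOT the two-background chart, NOT NE9; NOT summit progress (cell pub-balaban: NE9 NOT
PRINTED ∕ NOT PROVED («NE9 ⇐ the named binders»); row WALLED ON A MODEL (O-NE9-1); spine PROVED 0∕9; rung (B)+1 on a finite T⁴ — NOT infinite volume,
NOT mass gap, NOT Clay).  NEW file importing `B9Eq319CentreLiftL2`, `B9Eq319QprimeLipschitzTwoBackgrounds`; nothing of the leaf-03 ∕ leaf-04 ∕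
NE9-owner lineages' files is modified.  Net new unproved facts: 0.
-/

noncomputable section

open scoped BigOperators

namespace Literature.MathematicalPhysics.QuantumFieldTheory.Balaban1983to89.B9Eq319CentreLiftL2TwoBackgrounds

open B4Sect5Torus (TSite)
open B9SectCLatticeCarrier (Bond)
open B9Eq319Onto (centreFun)
open B9Eq319QprimeTorus (fineP centre weight)
open B9Eq310HessianOperator (adTransportW)
open B9Eq326OperatorAssembly (QprimeW)
open B9Eq311L2Pairing (WL2)
open B11Eq103H1Complex (SiteL2K)
open B9Eq319CentreLiftL2 (norm_sq_centreLift_eq)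
open B9Eq319QprimeLipschitzTwoBackgrounds (sum_norm_sq_QprimeW_sub_QprimeW_le rho₂_nonneg)

variable {d : ℕ} (L : ℕ) [NeZero L] (m : Fin d → ℕ)
  {𝔸 : Type*} [Ring 𝔸] [Algebra ℂ 𝔸] {W : Type*} [NormedAddCommGroup W] [InnerProductSpace ℂ W] (φ : W ≃ₗ[ℂ] 𝔸) {c₀ : ℝ}
  [Fact (0 < c₀)] (U U' : Bond d (fineP L m) → 𝔸ˣ)

/-- **THE TWO-BACKGROUND `Q′`-REMAINDER THROUGH THE CENTRE LIFT, VOLUME-FREE**: for transporter families `R(U(b))`, `R(U′(b))` both `ε`-close to the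
identity on the fibre and `δ`-close to each other, `‖S₀(Q′(U)λ − Q′(U′)λ)‖_{L²} ≤ √(L^d)·d(L−1)·δ·(1+ε)^{d(L−1)}·‖λ‖_{L²}` — `c₀·(L^d)²` from the exact
Hilbert norm of the centre lift (`B9Eq319CentreLiftL2.norm_sq_centreLift_eq`) against `ρ′₂²·(L^d·c₀)⁻¹` from (ρ′)₂'s Hilbert currency
(`B9Eq319QprimeLipschitzTwoBackgrounds.sum_norm_sq_QprimeW_sub_QprimeW_le`); the `hρ₂`-slots of `B9Eq368ProjectionRemainder.norm_projR_sub_projR_le` as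
instantiated in (Q3a)₂, without `C_S = L^d√(c₀|T|)`. [cite: Balaban1985BackgroundPropagators, (3.19) p.393, (3.65) p.403, (3.68) p.403, (3.76) p.405] -/
theorem norm_centreLift_QprimeW_sub_QprimeW_le {ε δ : ℝ} (hε : 0 ≤ ε) (hδ : 0 ≤ δ)
    (hR : ∀ b w, ‖adTransportW φ U b w - w‖ ≤ ε * ‖w‖) (hR' : ∀ b w, ‖adTransportW φ U' b w - w‖ ≤ ε * ‖w‖)
    (hRR' : ∀ b w, ‖adTransportW φ U b w - adTransportW φ U' b w‖ ≤ δ * ‖w‖) (lam : SiteL2K ℂ d (fineP L m) c₀ W) :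
    ‖(WL2.equiv ℂ (fun _ : TSite d (fineP L m) => c₀) W).symm (centreFun (weight L m) (centre L m)
        (QprimeW L m φ U (c₀ := c₀) lam - QprimeW L m φ U' (c₀ := c₀) lam))‖ ≤
      Real.sqrt ((L : ℝ) ^ d) * ((d * (L - 1) : ℕ) * δ * (1 + ε) ^ (d * (L - 1))) * ‖lam‖ := by
  have hc : 0 < c₀ := Fact.out
  have hL0 : (0 : ℝ) < (L : ℝ) ^ d := pow_pos (Nat.cast_pos.2 (Nat.pos_of_ne_zero (NeZero.ne L))) d
  have hρ := rho₂_nonneg L (d := d) hε hδ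
  have hsum := sum_norm_sq_QprimeW_sub_QprimeW_le L m φ U U' (c₀ := c₀) hε hδ hR hR' hRR' lam
  refine (pow_le_pow_iff_left₀ (norm_nonneg _) (mul_nonneg (mul_nonneg (Real.sqrt_nonneg _) hρ) (norm_nonneg _)) two_ne_zero).1 ?_
  rw [norm_sq_centreLift_eq]
  simp only [Pi.sub_apply]
  calc c₀ * ((L : ℝ) ^ d) ^ 2 * ∑ y, ‖QprimeW L m φ U (c₀ := c₀) lam y - QprimeW L m φ U' (c₀ := c₀) lam y‖ ^ 2
      ≤ c₀ * ((L : ℝ) ^ d) ^ 2 * (((d * (L - 1) : ℕ) * δ * (1 + ε) ^ (d * (L - 1))) ^ 2 * (((L : ℝ) ^ d * c₀)⁻¹ * ‖lam‖ ^ 2)) :=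
        mul_le_mul_of_nonneg_left hsum (by positivity)
    _ = (Real.sqrt ((L : ℝ) ^ d) * ((d * (L - 1) : ℕ) * δ * (1 + ε) ^ (d * (L - 1))) * ‖lam‖) ^ 2 := by
        have hs : Real.sqrt ((L : ℝ) ^ d) ^ 2 = (L : ℝ) ^ d := Real.sq_sqrt hL0.le
        rw [show (Real.sqrt ((L : ℝ) ^ d) * ((d * (L - 1) : ℕ) * δ * (1 + ε) ^ (d * (L - 1))) * ‖lam‖) ^ 2 =
            Real.sqrt ((L : ℝ) ^ d) ^ 2 * ((d * (L - 1) : ℕ) * δ * (1 + ε) ^ (d * (L - 1))) ^ 2 * ‖lam‖ ^ 2 by ring, hs]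
        field_simp

/-- **THE SAME, LINEAR SHAPE FOR `ε ≤ 1`**: `‖S₀(Q′(U)λ − Q′(U′)λ)‖ ≤ √(L^d)·(d(L−1)·2^{d(L−1)})·δ·‖λ‖` (`(1+ε)^{d(L−1)} ≤ 2^{d(L−1)}`) — the shape of
(Q3a)₂'s `C_ρ`-letters with `C_S·c₀^{−1∕2}` replaced by `√(L^d)`. [cite: Balaban1985BackgroundPropagators, (3.19) p.393, (3.68) p.403, (3.76) p.405] -/
theorem norm_centreLift_QprimeW_sub_QprimeW_le_linear {ε δ : ℝ} (hε : 0 ≤ ε) (hε1 : ε ≤ 1) (hδ : 0 ≤ δ)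
    (hR : ∀ b w, ‖adTransportW φ U b w - w‖ ≤ ε * ‖w‖) (hR' : ∀ b w, ‖adTransportW φ U' b w - w‖ ≤ ε * ‖w‖)
    (hRR' : ∀ b w, ‖adTransportW φ U b w - adTransportW φ U' b w‖ ≤ δ * ‖w‖) (lam : SiteL2K ℂ d (fineP L m) c₀ W) :
    ‖(WL2.equiv ℂ (fun _ : TSite d (fineP L m) => c₀) W).symm (centreFun (weight L m) (centre L m)
        (QprimeW L m φ U (c₀ := c₀) lam - QprimeW L m φ U' (c₀ := c₀) lam))‖ ≤
      Real.sqrt ((L : ℝ) ^ d) * ((d * (L - 1) : ℕ) * 2 ^ (d * (L - 1))) * δ * ‖lam‖ := by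
  refine (norm_centreLift_QprimeW_sub_QprimeW_le L m φ U U' hε hδ hR hR' hRR' lam).trans ?_
  have h2 : (1 + ε) ^ (d * (L - 1)) ≤ 2 ^ (d * (L - 1)) := pow_le_pow_left₀ (by positivity) (by linarith) _
  have h3 : (d * (L - 1) : ℕ) * δ * (1 + ε) ^ (d * (L - 1)) ≤ (d * (L - 1) : ℕ) * 2 ^ (d * (L - 1)) * δ := by
    calc ((d * (L - 1) : ℕ) : ℝ) * δ * (1 + ε) ^ (d * (L - 1)) ≤ (d * (L - 1) : ℕ) * δ * 2 ^ (d * (L - 1)) :=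
          mul_le_mul_of_nonneg_left h2 (by positivity)
      _ = (d * (L - 1) : ℕ) * 2 ^ (d * (L - 1)) * δ := by ring
  calc Real.sqrt ((L : ℝ) ^ d) * ((d * (L - 1) : ℕ) * δ * (1 + ε) ^ (d * (L - 1))) * ‖lam‖
      ≤ Real.sqrt ((L : ℝ) ^ d) * ((d * (L - 1) : ℕ) * 2 ^ (d * (L - 1)) * δ) * ‖lam‖ := by gcongr
    _ = Real.sqrt ((L : ℝ) ^ d) * ((d * (L - 1) : ℕ) * 2 ^ (d * (L - 1))) * δ * ‖lam‖ := by ring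

end Literature.MathematicalPhysics.QuantumFieldTheory.Balaban1983to89.B9Eq319CentreLiftL2TwoBackgrounds

end
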